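import Literature.NumberTheory.EllipticCurves.LambdaAdicSelmerDataToCoeffTwistH1
import Literature.NumberTheory.EllipticCurves.LambdaAdicSelmerDataToEisensteinH1Linear
import Literature.NumberTheory.EllipticCurves.ZpExtensionCoeffTwistCoeffActionProofs
import HarnessLib

/-!
# The level maps `𝔖_p(K_∞) → H¹(K, E[p^k] ⊗ (Λ/I)(ψ⁻¹))` of the `Λ`-adic source tower are `Λ`-LINEAR
# (proofs file: theorems only)

Topic `NumberTheory/EllipticCurves` (sequel of `LambdaAdicSelmerDataToCoeffTwistH1` and
`ZpExtensionCoeffTwistCoeffActionProofs`; the generic-coefficient twin of `LambdaAdicSelmerDataToEisensteinH1Linear` §1,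
D1 lineage p639748). Cell `pub/bsd-print-x9`, seat `bsd-line-x9-p2` (g3), Λ-adic SOURCE side of STUB 2 of the shared
μ-item of crux stmt-BirchSwinnertonDyer-27077.

Setting: `E = V` elliptic over a number field `K`, `κ : ZpExtension K p` with topological generator `γ`,
`D : V.LambdaAdicSelmerData κ γ` (`T ↦ conj_γ − 1`, `C c ↦ (c mod p^k)` levelwise, continuity `proj_cont`), an ideal
`I ⊆ Λ` with `ω_J = (1+T)^{p^J} − 1 ∈ I`, coefficient ring `A = Λ/I`, `u = [1 + T]`, and the level components
`coeffComponent D hu k n hn : 𝔖 → H¹(K, E[p^k] ⊗ (Λ/I)(ψ⁻¹))` at the inverse extension `κ⁻`.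

* `coeffComponent_X_smul` (`T`: `proj_X`, `coresCoeff_unitTwist_conjMap_of_isTopGenerator`, `[T] ↦ u• − id`),
  `coeffComponent_C_smul` (constants: `proj_C`, `[C c] ↦ (c mod p^k)•`), `coeffComponent_smul_eq_zero_of_forall_coeff_eq_zero`
  (`proj_cont`), `coeffComponent_X_pow_smul`, `coeffComponent_coe_smul` (polynomials), and
  **`coeffComponent_smul`**: for EVERY `g ∈ Λ` and every layer `n ≥ J` with `X^N ∈ I` for some `N ≤ k p^n` (`I` OPEN),
  `comp (g • s) = H¹([g] •) (comp s)` — truncation `g = g_{<kp^n} + tail`, the tail acting by `0` on both sides.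
So the family `k ↦ comp_k` is a `Λ`-linear map into any `Λ`-adic tower whose levels are the `E[p^k] ⊗ (Λ/I_k)(ψ⁻¹)` with
`Λ` acting through `H¹([g] •)` (Howard's `𝔖 ≅ H¹(K, 𝐓)`); the bundling against a specific tower (`AdicTower.limitH1`,
`smulFamily`) is left to the consumer that fixes the tower. THEOREMS ONLY; no definition, no named fact, no instance,
no `sorry`. BSD is not proved by any of this.

References: [Howard2004HeegnerKolyvagin] B. Howard, Compositio Math. 140 (2004), §2.2, Def. 2.2.3 (𝔖 ≅ H¹(K, 𝐓) as
Λ-modules), Rem. 1.2.4; [PerrinRiou1987BSMF] §0 pp. 401–402; [Washington1997] §7.1, §13.1–§13.2; [SerreGaloisCohomology1997] I §2.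
-/

noncomputable section

open scoped Topology Classical ContRepresentation
open Field CategoryTheory

universe u

namespace WeierstrassCurve.LambdaAdicSelmerData

open Literature.NumberTheory.EllipticCurves Literature.NumberTheory.GaloisRepresentations
open Literature.NumberTheory.EllipticCurves.ZpExtension (mk_one_add_X_pow_prime_pow_eq_one)

variable {K : Type u} [Field K] [NumberField K] {V : WeierstrassCurve K} [V.IsElliptic] {p : ℕ} [hp : Fact p.Prime]
  {κ : ZpExtension K p} {γ : absoluteGaloisGroup K} (D : V.LambdaAdicSelmerData κ γ)
  {I : Ideal (IwasawaAlgebra p)} {J : ℕ} (hJ : ((1 + PowerSeries.X : IwasawaAlgebra p) ^ (p ^ J) - 1) ∈ I)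

omit [V.IsElliptic] in
/-- **`T` on `𝔖` ↔ `[T]` on `H¹`**: `comp (T • s) = H¹([T] •) (comp s)` — `T` acts on `𝔖` as `conj_γ − 1` (`proj_X`),
`coresCoeff` at the inverse extension turns `conj_γ` into `u •` (`coresCoeff_unitTwist_conjMap_of_isTopGenerator`), and
`[T] = u − 1` acts as `H¹(u •) − id`. [cite: Howard2004HeegnerKolyvagin, §2.2 (Γ_K acts on Λ through γ ↦ 1 + T; 𝔖 ≅ H¹(K, 𝐓) is Λ-linear)]
[cite: Washington1997, §13.1–§13.2] -/
theorem coeffComponent_X_smul (hγ : κ.IsTopGenerator γ) (k n : ℕ) (hn : J ≤ n) (s : D.S) :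
    D.coeffComponent (mk_one_add_X_pow_prime_pow_eq_one I hJ) k n hn ((PowerSeries.X : IwasawaAlgebra p) • s) =
      galoisCohomology.map ((κ.unitTwist (-1)).coeffTwistSMulHom (V.torsionGaloisModule ((p : ℤ) ^ k))
        (mk_one_add_X_pow_prime_pow_eq_one I hJ) (Ideal.Quotient.mk I PowerSeries.X)) 1
        (D.coeffComponent (mk_one_add_X_pow_prime_pow_eq_one I hJ) k n hn s) := by
  haveI := κ.fintypeQuotientLayer n
  have hX := congrFun (D.proj_X n s) k
  simp only [conjPi, AddMonoidHom.pi_apply, AddMonoidHom.coe_comp, Function.comp_apply,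
    Pi.evalAddMonoidHom_apply, Pi.sub_apply] at hX
  rw [coeffComponent_apply, coeffComponent_apply, hX]
  erw [AddMonoidHom.map_sub]
  rw [V.conjH1_geomTorsion_eq_conjMap,
    κ.coresCoeff_unitTwist_conjMap_of_isTopGenerator (V.torsionGaloisModule ((p : ℤ) ^ k))
      (mk_one_add_X_pow_prime_pow_eq_one I hJ) hγ (κ.layerSubgroup n)
      (layerSubgroup_le_unitTwist_layerSubgroup_of_le hn) (κ.isOpen_layerSubgroup n),
    ZpExtension.map_coeffTwistSMulHom_mk_X _ _ hJ]

omit [V.IsElliptic] in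
/-- **Constants**: `comp (C c • s) = H¹([C c] •) (comp s)` (`proj_C`: `C c` acts on the `k`-th component as the integer
`c mod p^k`, and so does `[C c]` on `H¹(K, E[p^k] ⊗ (Λ/I)(χ))`, `map_coeffTwistSMulHom_mk_C`).
[cite: Howard2004HeegnerKolyvagin, §2.2] [cite: PerrinRiou1987BSMF, §0 p. 401] -/
theorem coeffComponent_C_smul (k n : ℕ) (hn : J ≤ n) (c : ℤ_[p]) (s : D.S) :
    D.coeffComponent (mk_one_add_X_pow_prime_pow_eq_one I hJ) k n hn (PowerSeries.C c • s) =
      galoisCohomology.map ((κ.unitTwist (-1)).coeffTwistSMulHom (V.torsionGaloisModule ((p : ℤ) ^ k))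
        (mk_one_add_X_pow_prime_pow_eq_one I hJ) (Ideal.Quotient.mk I (PowerSeries.C c))) 1
        (D.coeffComponent (mk_one_add_X_pow_prime_pow_eq_one I hJ) k n hn s) := by
  haveI := κ.fintypeQuotientLayer n
  have hC := congrFun (D.proj_C n s c) k
  simp only [padicPi, AddMonoidHom.pi_apply, AddMonoidHom.coe_comp, Function.comp_apply,
    Pi.evalAddMonoidHom_apply, zsmulAddGroupHom_apply] at hC
  rw [coeffComponent_apply, coeffComponent_apply, hC]
  erw [AddMonoidHom.map_zsmul]
  rw [ZpExtension.map_coeffTwistSMulHom_mk_C _ k hJ]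

omit [V.IsElliptic] in
/-- **Continuity**: a power series without terms of degree `< k p^n` kills the level-`(n, k)` component (`proj_cont`),
for ANY coefficient ring. [cite: PerrinRiou1987BSMF, §0 p. 402] [cite: Howard2004HeegnerKolyvagin, §2.2] -/
theorem coeffComponent_smul_eq_zero_of_forall_coeff_eq_zero {A : Type} [CommRing A] {u : A} (hu : u ^ (p ^ J) = 1)
    (k n : ℕ) (hn : J ≤ n) (g : IwasawaAlgebra p) (hg : ∀ i < k * p ^ n, PowerSeries.coeff i g = 0) (s : D.S) :
    D.coeffComponent hu k n hn (g • s) = 0 := by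
  haveI := κ.fintypeQuotientLayer n
  rw [coeffComponent_apply, D.proj_cont n k s g hg]
  exact map_zero _

omit [V.IsElliptic] in
/-- Powers of `T`: `comp (T^i • s) = H¹([T^i] •) (comp s)`. [cite: Howard2004HeegnerKolyvagin, §2.2] -/
theorem coeffComponent_X_pow_smul (hγ : κ.IsTopGenerator γ) (k n : ℕ) (hn : J ≤ n) (i : ℕ) (s : D.S) :
    D.coeffComponent (mk_one_add_X_pow_prime_pow_eq_one I hJ) k n hn ((PowerSeries.X : IwasawaAlgebra p) ^ i • s) =
      galoisCohomology.map ((κ.unitTwist (-1)).coeffTwistSMulHom (V.torsionGaloisModule ((p : ℤ) ^ k))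
        (mk_one_add_X_pow_prime_pow_eq_one I hJ) (Ideal.Quotient.mk I (PowerSeries.X ^ i))) 1
        (D.coeffComponent (mk_one_add_X_pow_prime_pow_eq_one I hJ) k n hn s) := by
  induction i with
  | zero => rw [pow_zero, one_smul, map_one, ZpExtension.map_coeffTwistSMulHom_one]
  | succ i ih =>
    rw [pow_succ', mul_smul, D.coeffComponent_X_smul hJ hγ, ih, map_mul, ZpExtension.map_coeffTwistSMulHom_mul]

omit [V.IsElliptic] in
/-- **Polynomials**: `comp (P • s) = H¹([P] •) (comp s)` for `P ∈ ℤ_p[T] ⊆ Λ`. [cite: Howard2004HeegnerKolyvagin, §2.2] -/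
theorem coeffComponent_coe_smul (hγ : κ.IsTopGenerator γ) (k n : ℕ) (hn : J ≤ n) (P : Polynomial ℤ_[p]) (s : D.S) :
    D.coeffComponent (mk_one_add_X_pow_prime_pow_eq_one I hJ) k n hn ((P : IwasawaAlgebra p) • s) =
      galoisCohomology.map ((κ.unitTwist (-1)).coeffTwistSMulHom (V.torsionGaloisModule ((p : ℤ) ^ k))
        (mk_one_add_X_pow_prime_pow_eq_one I hJ) (Ideal.Quotient.mk I (P : IwasawaAlgebra p))) 1
        (D.coeffComponent (mk_one_add_X_pow_prime_pow_eq_one I hJ) k n hn s) := by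
  induction P using Polynomial.induction_on' with
  | add P Q hP hQ =>
    rw [Polynomial.coe_add, add_smul, map_add (D.coeffComponent (mk_one_add_X_pow_prime_pow_eq_one I hJ) k n hn),
      hP, hQ, (κ.unitTwist (-1)).map_coeffTwistSMulHom_congr _ _
        (map_add (Ideal.Quotient.mk I) (P : IwasawaAlgebra p) (Q : IwasawaAlgebra p)),
      ZpExtension.map_coeffTwistSMulHom_add]
  | monomial i c =>
    rw [← Polynomial.C_mul_X_pow_eq_monomial, Polynomial.coe_mul, Polynomial.coe_pow, Polynomial.coe_C,
      Polynomial.coe_X, mul_smul, D.coeffComponent_C_smul hJ, D.coeffComponent_X_pow_smul hJ hγ,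
      ← ZpExtension.map_coeffTwistSMulHom_mul, ← map_mul]

omit [V.IsElliptic] in
/-- **Every `g ∈ Λ` (`I` open)**: `comp_{k,n} (g • s) = H¹([g] •) (comp_{k,n} s)` at every layer `n ≥ J` such that
`X^N ∈ I` for some `N ≤ k p^n` — split `g = trunc_{kp^n} g + tail`; the polynomial part is `coeffComponent_coe_smul`, the
tail acts by `0` on `𝔖`'s component (`proj_cont`) and by `0` on `H¹` (`X^N ∣ tail`, `map_coeffTwistSMulHom_mk_eq_zero_of_forall_coeff_eq_zero`).
[cite: Howard2004HeegnerKolyvagin, §2.2 and Def. 2.2.3 (𝔖 ≅ H¹(K, 𝐓) is an isomorphism of Λ-modules)] [cite: PerrinRiou1987BSMF, §0 p. 402] -/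
theorem coeffComponent_smul (hγ : κ.IsTopGenerator γ) (k n : ℕ) (hn : J ≤ n) {N : ℕ}
    (hN : (PowerSeries.X : IwasawaAlgebra p) ^ N ∈ I) (hNn : N ≤ k * p ^ n) (g : IwasawaAlgebra p) (s : D.S) :
    D.coeffComponent (mk_one_add_X_pow_prime_pow_eq_one I hJ) k n hn (g • s) =
      galoisCohomology.map ((κ.unitTwist (-1)).coeffTwistSMulHom (V.torsionGaloisModule ((p : ℤ) ^ k))
        (mk_one_add_X_pow_prime_pow_eq_one I hJ) (Ideal.Quotient.mk I g)) 1
        (D.coeffComponent (mk_one_add_X_pow_prime_pow_eq_one I hJ) k n hn s) := by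
  set M := k * p ^ n with hM
  set r : IwasawaAlgebra p := g - ((PowerSeries.trunc M g : Polynomial ℤ_[p]) : IwasawaAlgebra p) with hr
  have hg : g = ((PowerSeries.trunc M g : Polynomial ℤ_[p]) : IwasawaAlgebra p) + r := by rw [hr, add_sub_cancel]
  have hr0 : ∀ i < k * p ^ n, PowerSeries.coeff i r = 0 := fun i hi ↦ coeff_sub_trunc_eq_zero g M i hi
  have hr0' : ∀ i < N, PowerSeries.coeff i r = 0 := fun i hi ↦ hr0 i (lt_of_lt_of_le hi hNn)
  conv_lhs => rw [hg, add_smul, map_add (D.coeffComponent (mk_one_add_X_pow_prime_pow_eq_one I hJ) k n hn),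
    D.coeffComponent_coe_smul hJ hγ,
    D.coeffComponent_smul_eq_zero_of_forall_coeff_eq_zero (mk_one_add_X_pow_prime_pow_eq_one I hJ) k n hn r hr0, add_zero]
  conv_rhs => rw [hg, (κ.unitTwist (-1)).map_coeffTwistSMulHom_congr _ _
    (map_add (Ideal.Quotient.mk I) (((PowerSeries.trunc M g : Polynomial ℤ_[p]) : IwasawaAlgebra p)) r),
    ZpExtension.map_coeffTwistSMulHom_add,
    (κ.unitTwist (-1)).map_coeffTwistSMulHom_mk_eq_zero_of_forall_coeff_eq_zero _ hJ hN r hr0', add_zero]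

end WeierstrassCurve.LambdaAdicSelmerData

end
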